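import Summits.BirchSwinnertonDyer.BirchSwinnertonDyer.Theorems.SlopeDichotomyA2DegenerateLocusA2RegulatorFloorSharp
import Literature.NumberTheory.EllipticCurves.CanonicalPAdicHeightIntegralityBoundedIndexProofs
import HarnessLib

/-!
# Corner A2 with Tamagawa indices at most ONCE divisible by `p`: the Mazur–Tate floor `ord_p Reg_p ≥ −1` still
# holds (lcm bookkeeping), so `p ∣ ∏c_ℓ` gives the regulator–Tamagawa floor and T-λ3 — 800 of the 842
# residual A2 class-pairs of the height-integrality series, with NO isogeny and NO new fact

Support file (prover seat `bsd-schneider-i1-c2`, gen 7, cell `bsd-schneider-ideate`; `--supports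
stmt-BirchSwinnertonDyer-19086`), fourth of the regulator-floor series (`…RegulatorFloor` p448248,
`…RegulatorFloorPub` p448618, `…RegulatorFloorSharp` p449700; height-integrality series `…HeightIntegrality`
p460291 / `…Isogeny` p461719 / `…Neron` p464779). Those reduced memo ROUTE-P3-v8's T-λ3 («`λ_an ≥ 3` on corner
A2») to the floor AT THE PAIR `Reg_p ≠ 0 → 0 ≤ ord_p Reg_p + ord_p ∏c_ℓ` and proved it on the pairs with
`p ∤ [E(ℚ) : E(ℚ) ∩ E⁰(ℚ_ℓ)]` for every `ℓ` (exact census kit j258343: 1 955 of the 2 797 A2 class-pairs;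
1 765 by isogeny descent + 190 by `p ∣ ∏c_ℓ`), leaving a residue of 842 pairs where the generator meets a
component of order divisible by `p` at some bad prime — «E4 territory» (local heights off `E⁰`).

THIS FILE removes 800 of those 842 WITHOUT local heights, isogenies or new facts. The point (Literature
`CanonicalPAdicHeightIntegralityBoundedIndexProofs.lean`, p475274, PROVED: Mazur–Tate 1983 §3.3 with the
EXPONENTS `m_ℓ`, `n_p` — Mazur–Stein–Tate Alg. 3.4 step 1 «`m` could be the least common multiple of the
Tamagawa numbers of `E` and `#E(𝔽_p)`»): the admissible multiple can be taken with `ord_p m = max(ord_p N_p,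
max_ℓ ord_p e_ℓ)`, NOT the sum. On corner A2 `ord_p N_p = 1` (anomalous, Hasse), so if every Tamagawa index
`e_ℓ = [E(ℚ) : E(ℚ) ∩ E⁰(ℚ_ℓ)]` is at most once divisible by `p` (`p² ∤ e_ℓ`) the floor is STILL `ord_p Reg_p ≥ −1`
(§1) — and on that locus `p ∣ e_ℓ ∣ c_ℓ` at the offending prime makes `ord_p ∏c_ℓ ≥ 1`, i.e. the floor
`ord_p Reg_p + ord_p ∏c_ℓ ≥ 0` holds (§2) and T-λ3 follows (§3) by `…RegulatorFloorPub`. General `c`: indices with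
`ord_p ≤ c` give `ord_p Reg_p ≥ 1 − 2c`, enough when `2c ≤ 1 + ord_p ∏c_ℓ`.

CENSUS (g6's kit j258343 + j257621 re-tabulated, all 2 797 A2 class-pairs `N < 5·10⁵`, `a := max_ℓ ord_p e_ℓ`):
`a = 0` on 1 955 (1 765 with `p ∤ ∏c_ℓ`: isogeny road; 190 with `p ∣ ∏c_ℓ`: `…Sharp`), **`a = 1` on 800** (this
file, §3, `c = 1`), `a = 2` on 42 (3 with `ord_p ∏c_ℓ = 3`: this file with `c = 2`; 34 by the image-indexed
isogeny road of the companion `…HeightIntegralityImage.lean`; 5 genuinely E4: 11858z1, 225302bd1, 229658c1,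
245630t1, 443450cz1 at `p = 3`, where `ker φ` is `μ₃` at the prime `ℓ = 2` with `9 ∣ e₂`). By `p` for `a = 1`:
673 @3, 104 @5, 22 @7, 1 @13.

* §1 `valuation_padicRegulator_ge_of_typeBRankOne_of_index_le` (`1 − 2c ≤ ord_p Reg_p`),
  `neg_one_le_valuation_padicRegulator_of_typeBRankOne_of_not_sq_dvd_index` (`c = 1`: `−1 ≤ ord_p Reg_p`).
* §2 `regTamFloor_of_typeBRankOne_of_index_le` (floor from `2c ≤ 1 + ord_p ∏c_ℓ`),
  `regTamFloor_of_typeBRankOne_of_not_sq_dvd_index_of_dvd_tamagawa` (`p² ∤ e_ℓ ∀ℓ`, `p ∣ ∏c_ℓ`).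
* §3 **`not_analyticLambdaEq_one_of_typeBRankOne_of_not_sq_dvd_index_of_dvd_tamagawa`** (T-λ3: `λ_an ≠ 1`),
  `three_le_…` (`λ_an ≥ 3`), and the general-`c` forms — published inputs BY NAME (W16, BMS 1.7, GV 1.3,
  Greenberg 5.10, Mazur–Tate σ, modularity, GZK) + two per-pair DECIDABLE data (`p² ∤ e_ℓ`, `p ∣ ∏c_ℓ`).
* §4 `mazurMainConjecture_and_bsdp_of_typeBRankOne_of_lamThree_of_schneider_of_not_sq_dvd_index` — x1b's P₃
  road (`λ_an = 3` + bare Schneider certificate ⇒ Mazur MC ∧ BSD(E,p)) with BOTH valued inputs discharged on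
  the enlarged locus `{p² ∤ indices, p ∣ ∏c_ℓ}` (990 census pairs instead of `…Sharp`'s 190).

HONEST NOTE. Item 19086 is untouched (DECIDED-REDUCED, gens 0–6: not closable in the tree in either direction;
refutation budget re-read gen 7, nothing certifiable); BSD is not advanced; every theorem is conditional on the
named facts; these constrain the COMPLEMENT `{λ_an = 1}` of the locus `{λ_an ≥ 3} ⊇ {Reg_p = 0}` where 19086 has
content. The residue of T-λ3 on the census after this file and its companion is 5 pairs (E4 proper).

References: [MazurTate1983Biext] §1.2, §3.3, (4.1.1); [MazurSteinTate2006] Alg. 3.4 step 1, §4 p. 19;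
[BalakrishnanMullerStein2015] Thm. 1.7; [GreenbergVatsal2000] Thm. (1.3); [GreenbergLNM1716] Prop. 3.10, 5.10;
[Wuthrich2014] Thm. 16; cell memo ROUTE-P3-v8-lambda-g10 §1.3–1.4; FINDING-i1-c2-g6 §2b; FINDING-i1-c2-g7.
-/

set_option autoImplicit false

noncomputable section

open scoped Classical MatrixGroups ModularForm

open PowerSeries CongruenceSubgroup WeierstrassCurve Literature.NumberTheory.EllipticCurves
  Literature.NumberTheory.EllipticCurves.ModularForms
  Literature.NumberTheory.EllipticCurves.Rank1Residual
  Literature.NumberTheory.EllipticCurves.Greenberg1999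
  Summit.BirchSwinnertonDyer.Rank1Residual
  Summit.BirchSwinnertonDyer.BirchSwinnertonDyer.Theorems.Rank1ResidualX1Defs
  Summit.BirchSwinnertonDyer.Rank1Residual.X1.MuLambda
  Summit.BirchSwinnertonDyer.Rank1Residual.X1.MuPart
  Summit.BirchSwinnertonDyer.Rank1Residual.X1.ParitySqueeze
  Summit.BirchSwinnertonDyer.BirchSwinnertonDyer.Theses
  Summit.BirchSwinnertonDyer.BirchSwinnertonDyer.Theorems

-- `Summit.BirchSwinnertonDyer.BirchSwinnertonDyer.…`: the summit and its single sub-problem share a name (D-0017 layout).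
set_option linter.dupNamespace false

namespace Summit.BirchSwinnertonDyer.BirchSwinnertonDyer.Theorems.DegenerateLocusA2RegulatorFloorBoundedIndex

variable {W : WeierstrassCurve ℚ} [W.IsElliptic] [W.IsGloballyMinimal] {p : ℕ} [Fact p.Prime]

/-! ## §1. The Mazur–Tate floor on corner A2 with Tamagawa indices of bounded `p`-part -/

/-- **On corner A2, `1 − 2c ≤ ord_p Reg_p` for THE canonical regulator** whenever it is non-zero, provided
`1 ≤ c` and `p^{c+1} ∤ [E(ℚ) : E(ℚ) ∩ E⁰(ℚ_ℓ)]` for every prime `ℓ`: Mazur–Tate 1983 §3.3 with the exponents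
(`valuation_padicRegulator_ge_of_index_le`, PROVED, lcm bookkeeping), `ord_p #Ẽ(𝔽_p) = 1 ≤ c` on the leaf,
`rank = 1` by GZK (`hGZK`). [cite: MazurTate1983Biext, §3.3 (display after (3.3.4)) and (4.1.1)]
[cite: MazurSteinTate2006, Alg. 3.4 step 1] -/
theorem valuation_padicRegulator_ge_of_typeBRankOne_of_index_le
    (hGZK : rank_eq_analyticRank_of_analyticRank_le_one) (hB : X1.TypeBRankOne W p) {c : ℕ} (hc : 1 ≤ c)
    (hidx : ∀ (ℓ : ℕ) [Fact ℓ.Prime], ¬ p ^ (c + 1) ∣ (W.nonsingularReductionSubgroupAt ℓ).index)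
    {Dh : PAdicHeightData W p} (hDh : Dh.IsCanonical) (hR : padicRegulator Dh ≠ 0) :
    1 - 2 * (c : ℤ) ≤ (padicRegulator Dh).valuation := by
  have hX := isClassX1_of_classX1 hB.1
  have hL : X1.RankOne.Leaf W p := X1.RankOne.leaf_of_classX1 hB.1 hB.2.1
  have hp3 : 3 ≤ p := by
    have h2 := hB.1.1
    have hp2 := hX.two_ne
    omega
  have hN : padicValNat p (W.reductionPointCount p) ≤ c := by
    rw [hL.padicValNat_reductionPointCount_eq_one]; exact hc
  have h := valuation_padicRegulator_ge_of_index_le W p hp3 hX.hasGoodReductionAtPrime hN hidx hDh hR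
  obtain ⟨hrk, -⟩ := hGZK W hB.2.1.le
  have hr1 : (W.mordellWeilRank : ℤ) = 1 := by exact_mod_cast hrk.trans hB.2.1
  rw [hr1, mul_one] at h
  exact h

/-- **On corner A2 with `p² ∤ [E(ℚ) : E(ℚ) ∩ E⁰(ℚ_ℓ)]` for every `ℓ`, `−1 ≤ ord_p Reg_p`** for THE canonical
regulator (`c = 1`): the SAME floor as `…RegulatorFloorSharp.neg_one_le_valuation_padicRegulator_of_typeBRankOne`
(`p ∤` the indices), because the anomalous factor `p` of `N_p` and the Tamagawa factor `p` are shared in the least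
common multiple. Census: holds on 800 further A2 class-pairs (every Tamagawa index once divisible by `p`).
[cite: MazurTate1983Biext, §3.3 and (4.1.1)] [cite: MazurSteinTate2006, Alg. 3.4 step 1 and §4 p. 19] -/
theorem neg_one_le_valuation_padicRegulator_of_typeBRankOne_of_not_sq_dvd_index
    (hGZK : rank_eq_analyticRank_of_analyticRank_le_one) (hB : X1.TypeBRankOne W p)
    (hidx : ∀ (ℓ : ℕ) [Fact ℓ.Prime], ¬ p ^ 2 ∣ (W.nonsingularReductionSubgroupAt ℓ).index)
    {Dh : PAdicHeightData W p} (hDh : Dh.IsCanonical) (hR : padicRegulator Dh ≠ 0) :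
    -1 ≤ (padicRegulator Dh).valuation := by
  have h := valuation_padicRegulator_ge_of_typeBRankOne_of_index_le hGZK hB (c := 1) le_rfl hidx hDh hR
  push_cast at h
  linarith

/-! ## §2. The regulator–Tamagawa floor (the binder `hRT` of `…RegulatorFloorPub`) on the bounded-index locus -/

/-- **Floor from bounded indices and enough Tamagawa valuation**: on corner A2, if `1 ≤ c`,
`p^{c+1} ∤ [E(ℚ) : E(ℚ) ∩ E⁰(ℚ_ℓ)]` for every `ℓ` and `2c ≤ 1 + ord_p ∏c_ℓ`, then EVERY canonical datum has
`Reg_p ≠ 0 → 0 ≤ ord_p Reg_p + ord_p ∏c_ℓ`. [cite: MazurTate1983Biext, §3.3 and (4.1.1)]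
[cite: MazurSteinTate2006, Alg. 3.4 step 1] -/
theorem regTamFloor_of_typeBRankOne_of_index_le
    (hGZK : rank_eq_analyticRank_of_analyticRank_le_one) (hB : X1.TypeBRankOne W p) {c : ℕ} (hc : 1 ≤ c)
    (hidx : ∀ (ℓ : ℕ) [Fact ℓ.Prime], ¬ p ^ (c + 1) ∣ (W.nonsingularReductionSubgroupAt ℓ).index)
    (hTam : 2 * c ≤ 1 + padicValNat p W.tamagawaProduct) :
    ∀ Dh : PAdicHeightData W p, Dh.IsCanonical → padicRegulator Dh ≠ 0 →
      0 ≤ (padicRegulator Dh).valuation + (padicValNat p W.tamagawaProduct : ℤ) := by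
  intro Dh hDh hR
  have h := valuation_padicRegulator_ge_of_typeBRankOne_of_index_le hGZK hB hc hidx hDh hR
  have hT : 2 * (c : ℤ) ≤ 1 + (padicValNat p W.tamagawaProduct : ℤ) := by exact_mod_cast hTam
  linarith

/-- **Floor on `{p² ∤ indices, p ∣ ∏c_ℓ}`**: on corner A2, if every Tamagawa index is at most once divisible
by `p` and `p ∣ ∏c_ℓ` (automatic when some index IS divisible by `p`, since `e_ℓ ∣ c_ℓ`; kept as a separate
decidable datum because the tree's `tamagawaProduct` is the `finprod` over places of the local indices of the
completions), then `Reg_p ≠ 0 → 0 ≤ ord_p Reg_p + ord_p ∏c_ℓ` for every canonical datum.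
[cite: MazurTate1983Biext, §3.3 and (4.1.1)] [cite: MazurSteinTate2006, Alg. 3.4 step 1] -/
theorem regTamFloor_of_typeBRankOne_of_not_sq_dvd_index_of_dvd_tamagawa
    (hGZK : rank_eq_analyticRank_of_analyticRank_le_one) (hB : X1.TypeBRankOne W p)
    (hidx : ∀ (ℓ : ℕ) [Fact ℓ.Prime], ¬ p ^ 2 ∣ (W.nonsingularReductionSubgroupAt ℓ).index)
    (hTam : p ∣ W.tamagawaProduct) :
    ∀ Dh : PAdicHeightData W p, Dh.IsCanonical → padicRegulator Dh ≠ 0 →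
      0 ≤ (padicRegulator Dh).valuation + (padicValNat p W.tamagawaProduct : ℤ) := by
  refine regTamFloor_of_typeBRankOne_of_index_le hGZK hB (c := 1) le_rfl hidx ?_
  have hpos : 0 < W.tamagawaProduct := W.tamagawaProduct_pos_holds
  have h1 : 1 ≤ padicValNat p W.tamagawaProduct := one_le_padicValNat_of_dvd hpos.ne' hTam
  omega

/-! ## §3. T-λ3 on the bounded-index locus (memo ROUTE-P3-v8 (T1)), published inputs + two decidable data -/

/-- **T-λ3 on corner A2 with bounded indices: `λ_an ≠ 1`** at every A2 pair with `1 ≤ c`,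
`p^{c+1} ∤ [E(ℚ) : E(ℚ) ∩ E⁰(ℚ_ℓ)]` for all `ℓ` and `2c ≤ 1 + ord_p ∏c_ℓ` — published inputs BY NAME (W16,
Perrin-Riou–Schneider = BMS 1.7, GV Thm. 1.3, Greenberg Prop. 5.10, Mazur–Tate σ, modularity, GZK), NO height value
inspected, NO isogeny. [cite: BalakrishnanMullerStein2015, Thm. 1.7] [cite: GreenbergVatsal2000, Thm. (1.3)]
[cite: GreenbergLNM1716, Prop. 5.10 (PDF p. 147)] [cite: Wuthrich2014, Thm. 16 (p. 393)]
[cite: MazurTate1983Biext, §3.3 and (4.1.1)] -/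
theorem not_analyticLambdaEq_one_of_typeBRankOne_of_index_le
    (hW16 : Wuthrich2014.charIdeal_dvd_padicLFunction) (hS : Schneider1985_order_charGenerator_odd)
    (hGV : GreenbergVatsal2000.thm13_charIdeal_eq_of_gvPar)
    (h510 : prop510_isTorsion_hasUnitContent_of_gvPar) (hMT : mazur_tate_sigma_exists_odd)
    (hmodP : nonempty_modularParametrizationData) (hGZK : rank_eq_analyticRank_of_analyticRank_le_one)
    (hB : X1.TypeBRankOne W p) {c : ℕ} (hc : 1 ≤ c)
    (hidx : ∀ (ℓ : ℕ) [Fact ℓ.Prime], ¬ p ^ (c + 1) ∣ (W.nonsingularReductionSubgroupAt ℓ).index)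
    (hTam : 2 * c ≤ 1 + padicValNat p W.tamagawaProduct) : ¬ AnalyticLambdaEq W p 1 :=
  DegenerateLocusA2RegulatorFloorPub.not_analyticLambdaEq_one_of_typeBRankOne_of_regTamFloor hW16 hS hGV
    h510 hMT hmodP hGZK hB (regTamFloor_of_typeBRankOne_of_index_le hGZK hB hc hidx hTam)

/-- **T-λ3, counted form, bounded indices: every certified `λ_an = n` has `n ≥ 3`** (λ-parity on rank one
excludes `λ_an = 2`). [cite: GreenbergVatsal2000, Thm. (1.3)] [cite: MazurTateTeitelbaum1986Invent, §I.17–I.18]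
[cite: MazurTate1983Biext, §3.3 and (4.1.1)] [cite: BalakrishnanMullerStein2015, Thm. 1.7] -/
theorem three_le_of_analyticLambdaEq_of_typeBRankOne_of_index_le
    (hW16 : Wuthrich2014.charIdeal_dvd_padicLFunction) (hS : Schneider1985_order_charGenerator_odd)
    (hGV : GreenbergVatsal2000.thm13_charIdeal_eq_of_gvPar)
    (h510 : prop510_isTorsion_hasUnitContent_of_gvPar) (hMT : mazur_tate_sigma_exists_odd)
    (hmodP : nonempty_modularParametrizationData) (hGZK : rank_eq_analyticRank_of_analyticRank_le_one)
    (hB : X1.TypeBRankOne W p) {c : ℕ} (hc : 1 ≤ c)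
    (hidx : ∀ (ℓ : ℕ) [Fact ℓ.Prime], ¬ p ^ (c + 1) ∣ (W.nonsingularReductionSubgroupAt ℓ).index)
    (hTam : 2 * c ≤ 1 + padicValNat p W.tamagawaProduct) {n : ℕ} (hn : AnalyticLambdaEq W p n) : 3 ≤ n :=
  DegenerateLocusA2RegulatorFloorPub.three_le_of_analyticLambdaEq_of_typeBRankOne_of_regTamFloor hW16 hS hGV
    h510 hMT hmodP hGZK hB (regTamFloor_of_typeBRankOne_of_index_le hGZK hB hc hidx hTam) hn

/-- **T-λ3 on `{p² ∤ indices, p ∣ ∏c_ℓ}` (800 + 190 census A2 class-pairs): `λ_an ≠ 1`** — published inputs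
BY NAME, the two per-pair data `p² ∤ [E(ℚ) : E(ℚ) ∩ E⁰(ℚ_ℓ)] ∀ℓ` and `p ∣ ∏c_ℓ`; NO height value inspected, NO
isogeny, NO fact beyond `…RegulatorFloorSharp`'s. Supersedes `…Sharp.not_analyticLambdaEq_one_of_typeBRankOne_of_dvd_tamagawa`
(hypothesis `p ∤` indices). [cite: BalakrishnanMullerStein2015, Thm. 1.7] [cite: GreenbergVatsal2000, Thm. (1.3)]
[cite: GreenbergLNM1716, Prop. 5.10 (PDF p. 147)] [cite: Wuthrich2014, Thm. 16 (p. 393)]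
[cite: MazurTate1983Biext, §3.3 and (4.1.1)] [cite: MazurSteinTate2006, Alg. 3.4 step 1] -/
theorem not_analyticLambdaEq_one_of_typeBRankOne_of_not_sq_dvd_index_of_dvd_tamagawa
    (hW16 : Wuthrich2014.charIdeal_dvd_padicLFunction) (hS : Schneider1985_order_charGenerator_odd)
    (hGV : GreenbergVatsal2000.thm13_charIdeal_eq_of_gvPar)
    (h510 : prop510_isTorsion_hasUnitContent_of_gvPar) (hMT : mazur_tate_sigma_exists_odd)
    (hmodP : nonempty_modularParametrizationData) (hGZK : rank_eq_analyticRank_of_analyticRank_le_one)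
    (hB : X1.TypeBRankOne W p)
    (hidx : ∀ (ℓ : ℕ) [Fact ℓ.Prime], ¬ p ^ 2 ∣ (W.nonsingularReductionSubgroupAt ℓ).index)
    (hTam : p ∣ W.tamagawaProduct) : ¬ AnalyticLambdaEq W p 1 :=
  DegenerateLocusA2RegulatorFloorPub.not_analyticLambdaEq_one_of_typeBRankOne_of_regTamFloor hW16 hS hGV
    h510 hMT hmodP hGZK hB (regTamFloor_of_typeBRankOne_of_not_sq_dvd_index_of_dvd_tamagawa hGZK hB hidx hTam)

/-- **T-λ3, counted form, on `{p² ∤ indices, p ∣ ∏c_ℓ}`: every certified `λ_an = n` has `n ≥ 3`.**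
[cite: GreenbergVatsal2000, Thm. (1.3)] [cite: MazurTateTeitelbaum1986Invent, §I.17–I.18]
[cite: MazurTate1983Biext, §3.3 and (4.1.1)] [cite: BalakrishnanMullerStein2015, Thm. 1.7] -/
theorem three_le_of_analyticLambdaEq_of_typeBRankOne_of_not_sq_dvd_index_of_dvd_tamagawa
    (hW16 : Wuthrich2014.charIdeal_dvd_padicLFunction) (hS : Schneider1985_order_charGenerator_odd)
    (hGV : GreenbergVatsal2000.thm13_charIdeal_eq_of_gvPar)
    (h510 : prop510_isTorsion_hasUnitContent_of_gvPar) (hMT : mazur_tate_sigma_exists_odd)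
    (hmodP : nonempty_modularParametrizationData) (hGZK : rank_eq_analyticRank_of_analyticRank_le_one)
    (hB : X1.TypeBRankOne W p)
    (hidx : ∀ (ℓ : ℕ) [Fact ℓ.Prime], ¬ p ^ 2 ∣ (W.nonsingularReductionSubgroupAt ℓ).index)
    (hTam : p ∣ W.tamagawaProduct) {n : ℕ} (hn : AnalyticLambdaEq W p n) : 3 ≤ n :=
  DegenerateLocusA2RegulatorFloorPub.three_le_of_analyticLambdaEq_of_typeBRankOne_of_regTamFloor hW16 hS hGV
    h510 hMT hmodP hGZK hB (regTamFloor_of_typeBRankOne_of_not_sq_dvd_index_of_dvd_tamagawa hGZK hB hidx hTam)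
    hn

/-! ## §4. x1b's P₃ road on the enlarged locus `{p² ∤ indices, p ∣ ∏c_ℓ}` (both valued inputs discharged) -/

/-- **P₃ on corner A2 from the BARE Schneider certificate, enlarged locus** (`p² ∤` local indices, `p ∣ ∏c_ℓ`;
990 census A2 class-pairs): `λ_an = 3` and `Reg_p ≠ 0` for every canonical datum ⇒ Mazur's MC ∧ BSD(E,p) — x1b's
`RankOne.Leaf.mazurMainConjecture_and_bsdp_of_lamThree` with `μ_an = 0` from GV Thm 1.3 + Greenberg 5.10, the
μ-part from W16, `htors` from type B, the valued half `v = −1` from §1 (lcm floor) and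
`hb : 0 + 0 + 1 < −1 + ord ∏c_ℓ + 2` from `p ∣ ∏c_ℓ`. Generalises
`…RegulatorFloorSharp.mazurMainConjecture_and_bsdp_of_typeBRankOne_of_lamThree_of_schneider_of_dvd_tamagawa`
(`p ∤` indices). Granted W16, Perrin-Riou–Schneider, PR87, Mazur–Tate σ, modularity, GZK, Greenberg 3.10/5.10,
GV 1.3 by name. [cite: GreenbergLNM1716, Prop. 3.10 and §5 p. 183] [cite: Wuthrich2014, Thm. 16 (p. 393)]
[cite: BalakrishnanMullerStein2015, Thm. 1.7] [cite: MazurTate1983Biext, §3.3] [cite: MazurSteinTate2006, Alg. 3.4 step 1] -/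
theorem mazurMainConjecture_and_bsdp_of_typeBRankOne_of_lamThree_of_schneider_of_not_sq_dvd_index
    (hW16 : Wuthrich2014.charIdeal_dvd_padicLFunction) (hS : Schneider1985_order_charGenerator_odd)
    (hPR : perrinRiou_rankOne_leadingTerms_odd) (hMT : mazur_tate_sigma_exists_odd)
    (hmodP : nonempty_modularParametrizationData) (hGZK : rank_eq_analyticRank_of_analyticRank_le_one)
    (h310 : prop310_selmerCorank_mod_two_eq_lambdaInvariant)
    (hGV : GreenbergVatsal2000.thm13_charIdeal_eq_of_gvPar)
    (h510 : prop510_isTorsion_hasUnitContent_of_gvPar) (hB : X1.TypeBRankOne W p)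
    (hidx : ∀ (ℓ : ℕ) [Fact ℓ.Prime], ¬ p ^ 2 ∣ (W.nonsingularReductionSubgroupAt ℓ).index)
    (hTam : p ∣ W.tamagawaProduct) (hlam3 : AnalyticLambdaEq W p 3)
    (hSch : ∀ Dh : PAdicHeightData W p, Dh.IsCanonical → padicRegulator Dh ≠ 0) :
    MazurMainConjecture W p ∧ BSDp W p := by
  have hX := isClassX1_of_classX1 hB.1
  have hL : X1.RankOne.Leaf W p := X1.RankOne.leaf_of_classX1 hB.1 hB.2.1
  have hμ0 : AnalyticMuLE W p 0 :=
    DegenerateLocusA2RegulatorFloorPub.analyticMuLE_zero_of_typeBRankOne hGV h510 hB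
  have hμ : MuPartAt W p := muPartAt_of_analyticMuLE_zero hW16 hX.two_ne hX.hasGoodReductionAtPrime
    hX.not_dvd_frobeniusTrace hX.not_hasIrreducibleModPGaloisRep hμ0
  refine hL.mazurMainConjecture_and_bsdp_of_lamThree hW16 hS hPR hMT hmodP hGZK h310 hμ0 hμ hlam3
    (v := -1) (fun Dh hDh ↦ ⟨hSch Dh hDh,
      neg_one_le_valuation_padicRegulator_of_typeBRankOne_of_not_sq_dvd_index hGZK hB hidx hDh
        (hSch Dh hDh)⟩) ?_
  have ht : (padicValNat p W.torsionOrder : ℤ) = 0 := by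
    exact_mod_cast padicValNat.eq_zero_of_not_dvd
      (DegenerateLocusA2RegulatorFloor.not_dvd_torsionOrder_of_typeBRankOne W p hB)
  have hN : (padicValNat p (W.reductionPointCount p) : ℤ) = 1 := by
    exact_mod_cast hL.padicValNat_reductionPointCount_eq_one
  have hpos : 0 < W.tamagawaProduct := W.tamagawaProduct_pos_holds
  have h1 : (1 : ℤ) ≤ padicValNat p W.tamagawaProduct := by
    exact_mod_cast one_le_padicValNat_of_dvd hpos.ne' hTam
  rw [ht, hN]
  push_cast at h1 ⊢
  linarith

end Summit.BirchSwinnertonDyer.BirchSwinnertonDyer.Theorems.DegenerateLocusA2RegulatorFloorBoundedIndex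

end
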